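import Summits.ValiantsHypothesis.ValiantsHypothesis.Theorems.LacunarySymmetroidMatrixDescartesShadowPathBound

/-!
# ValiantsHypothesis / LacunarySymmetroid — crux `MatrixDescartes` (stmt-ValiantsHypothesis-18050),
# line `Cruxes/MatrixDescartes/Lines/lorentzian_shadow.lean`, first rung `stub_shadowPath`:
# the format instances `(m, K) = (3,4), (4,4), (2,6)`

The line card names "exhaustive `ShadowPathBound` at `(3,4)/(4,4)/(2,6)`" as the cheapest falsifier
of the first rung.  As typed, each format instance still quantifies over ALL M-convex
`ν : (Fin K → ℕ) → ℚ` on all `D ⊆ Δ(m,K)` and over all injective weights `e : Fin K → ℕ`, so it is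
NOT a decidable proposition (no `decide`); the three instances are recorded here as kernel facts by
specialising the general theorem `shadowPathBound` (all `(m, K)`, file
`LacunarySymmetroidMatrixDescartesShadowPathBound.lean`): at most `m (K - 1) + 1 = 10, 13, 11`
shadow vertices respectively.  (Numerics of record: `10` and `13` are attained at `(3,4)`, `(4,4)`;
at `(2,6)` the instruments found `9`.)

Honest framing: instrument / record tier corollaries of the line's first rung (valuation side,
outside the cone of `MatrixDescartes_of`); the crux `LacunarySymmetroid.MatrixDescartes`,
Conjecture B and rung V1 do NOT move; `VP ≠ VNP` is NOT proved and nothing here is progress on it.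
No definitions.
-/

-- `Summit.ValiantsHypothesis.ValiantsHypothesis.…` is the tree's mandated single-conjunct layout
-- (Sub = Summit), so the duplicated namespace component is intended.
set_option linter.dupNamespace false
set_option autoImplicit false

namespace Summit.ValiantsHypothesis.ValiantsHypothesis.Theorems.LacunarySymmetroidMatrixDescartes

open Finset
open scoped BigOperators

/-- Format instance `(m, K) = (3, 4)` of the shadow path bound (at most `10` shadow vertices), a
corollary of `shadowPathBound` (not a finite computation: `ν`, `e` are universally quantified). -/
theorem shadowPathBound_three_four :
    ∀ (D : Finset (Fin 4 → ℕ)) (ν : (Fin 4 → ℕ) → ℚ) (e : Fin 4 → ℕ),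
      D ⊆ (Fintype.piFinset fun _ : Fin 4 => Finset.range (3 + 1)).filter (fun α => ∑ i, α i = 3) →
      (∀ α ∈ D, ∀ β ∈ D, ∀ i : Fin 4, β i < α i →
        ∃ j : Fin 4, α j < β j ∧ α - Pi.single i 1 + Pi.single j 1 ∈ D ∧
          β - Pi.single j 1 + Pi.single i 1 ∈ D ∧
          ν (α - Pi.single i 1 + Pi.single j 1) + ν (β - Pi.single j 1 + Pi.single i 1)
            ≤ ν α + ν β) →
      Function.Injective e →
        (@Finset.filter (Fin 4 → ℕ)
          (fun α => α ∈ D ∧ ∃ u : ℚ, ∀ β ∈ D, β ≠ α →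
            ν α + u * ((∑ i, e i * α i : ℕ) : ℚ) < ν β + u * ((∑ i, e i * β i : ℕ) : ℚ))
          (fun _ => Classical.propDecidable _) D).card ≤ 10 :=
  fun D ν e hD hν he => shadowPathBound 3 4 D ν e hD hν he

/-- Format instance `(m, K) = (4, 4)` of the shadow path bound (at most `13` shadow vertices). -/
theorem shadowPathBound_four_four :
    ∀ (D : Finset (Fin 4 → ℕ)) (ν : (Fin 4 → ℕ) → ℚ) (e : Fin 4 → ℕ),
      D ⊆ (Fintype.piFinset fun _ : Fin 4 => Finset.range (4 + 1)).filter (fun α => ∑ i, α i = 4) →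
      (∀ α ∈ D, ∀ β ∈ D, ∀ i : Fin 4, β i < α i →
        ∃ j : Fin 4, α j < β j ∧ α - Pi.single i 1 + Pi.single j 1 ∈ D ∧
          β - Pi.single j 1 + Pi.single i 1 ∈ D ∧
          ν (α - Pi.single i 1 + Pi.single j 1) + ν (β - Pi.single j 1 + Pi.single i 1)
            ≤ ν α + ν β) →
      Function.Injective e →
        (@Finset.filter (Fin 4 → ℕ)
          (fun α => α ∈ D ∧ ∃ u : ℚ, ∀ β ∈ D, β ≠ α →
            ν α + u * ((∑ i, e i * α i : ℕ) : ℚ) < ν β + u * ((∑ i, e i * β i : ℕ) : ℚ))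
          (fun _ => Classical.propDecidable _) D).card ≤ 13 :=
  fun D ν e hD hν he => shadowPathBound 4 4 D ν e hD hν he

/-- Format instance `(m, K) = (2, 6)` of the shadow path bound (at most `11` shadow vertices). -/
theorem shadowPathBound_two_six :
    ∀ (D : Finset (Fin 6 → ℕ)) (ν : (Fin 6 → ℕ) → ℚ) (e : Fin 6 → ℕ),
      D ⊆ (Fintype.piFinset fun _ : Fin 6 => Finset.range (2 + 1)).filter (fun α => ∑ i, α i = 2) →
      (∀ α ∈ D, ∀ β ∈ D, ∀ i : Fin 6, β i < α i →
        ∃ j : Fin 6, α j < β j ∧ α - Pi.single i 1 + Pi.single j 1 ∈ D ∧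
          β - Pi.single j 1 + Pi.single i 1 ∈ D ∧
          ν (α - Pi.single i 1 + Pi.single j 1) + ν (β - Pi.single j 1 + Pi.single i 1)
            ≤ ν α + ν β) →
      Function.Injective e →
        (@Finset.filter (Fin 6 → ℕ)
          (fun α => α ∈ D ∧ ∃ u : ℚ, ∀ β ∈ D, β ≠ α →
            ν α + u * ((∑ i, e i * α i : ℕ) : ℚ) < ν β + u * ((∑ i, e i * β i : ℕ) : ℚ))
          (fun _ => Classical.propDecidable _) D).card ≤ 11 :=
  fun D ν e hD hν he => shadowPathBound 2 6 D ν e hD hν he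

end Summit.ValiantsHypothesis.ValiantsHypothesis.Theorems.LacunarySymmetroidMatrixDescartes
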